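import Summits.QuantumFields.YangMills.Theorems.TunedSequenceExists.Negative.Glue
import Summits.QuantumFields.YangMills.Theorems.LangevinControlUVFemtoCurvatureTwoPointAxisProfileAntitone
import Summits.QuantumFields.YangMills.Theorems.EquipartitionCriticalityRPProbeCriticalityOddLimit

/-!
# Crux `TunedSequenceExists` (stmt-QuantumFields-10524): the RP-DIAGONAL VARIANT, part 1 — what
# changes if (S) is tuned by a time-zero plaquette instead of the corner action density
# (kernel-checked certificate for the planners, lead c3 of line `fixed-aspect-window`; not a proof
# of the crux; every docstring tag-free: folklore bridges to landed RP files, no published fact)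

The crux tunes Wilson schemes by the connected correlator of the CORNER action density
`P = r.curvature.F = Σ_{i<j} Re tr r(U_{p_ij(0)})`, which straddles the time slices `0, 1`
(three temporal plaquettes).  Lead c2 showed (`RPStraddleCounterexample.lean`) that `⟨P ; τ_n P⟩` is
NOT a reflection-positivity-diagonal quantity, and the wave-1 worker on stub (A) showed that the
canonical upper bound (A) for `P` carries infrared content of its own.  This file records,
kernel-checked, what the SAME statement looks like for the time-zero observable

  `Q := Re tr r(U_{p_{12}(0)})` (one spatial plaquette at the origin, `spatialPlaquette r`):

* `latticeConnectedCorr_spatialPlaquette_nonneg` — `0 ≤ ⟨Q ; τ_n Q⟩_{β, S}` for every compact `G`,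
  every `r`, every side `S`, every `β ≥ 0`, every `n` (landed RP: `AxisCovNonneg.timeAxisCov_nonneg`);
* `latticeConnectedCorr_spatialPlaquette_antitone` — `n ↦ ⟨Q ; τ_n Q⟩_{β, S}` is non-increasing on
  `2n ≤ S` (landed transfer monotonicity: `AxisCovNonneg.axisProfile_antitone`);
* hence clause (iii) of the crux is FREE for `Q`: `0 ≤ N_t(k) ≤ N_1(k)` whenever `2 t M^{n_k} ≤ side`
  (`rescaled_nonneg`, `rescaled_mul_le`) — no stub (A) is needed;
* `latticeConnectedCorr_spatialPlaquette_tendsto_zero` / `continuous_latticeConnectedCorr_spatialPlaquette`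
  — freezing and β-continuity for `Q` (same Laplace engine as for `P`);
* `volumeMonotoneQ_on_finset` — for `Q`, the volume quasi-monotonicity (V) restricted to ANY FINITE
  set of depths holds trivially (freezing on the small torus + non-negativity on the big one): the
  content of (V) for an RP-diagonal observable is purely the uniformity in the depth `m` at the
  tuned crossover (the continuum finite-size effect at aspect `L₁`), nothing else.

Part 2 (`…RPDiagonalVariant`) writes the `Q`-restated crux `TunedSequenceExistsQ` and the sorry-free
two-child glue `tunedSequenceExistsQ_of : FemtoWindowQAll → VolumeMonotoneQAll → TunedSequenceExistsQ`
(no upper-bound child).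

Physics is unchanged (the tuning pin is any canonically normalised gauge-invariant dimension-4
two-point function; `⟨tr B²(0) tr B²(t e₀)⟩` is the scalar channel).  Whether to restate (S) — and the
tuning hypotheses of (A) `ContinuumLimitOnTrajectory` / (B) `LatticeGapOnTrajectory` that consume the
tuned scheme — is the planners' decision; this file only certifies the gain.
-/

noncomputable section

open Filter Topology MeasureTheory
open Literature.MathematicalPhysics.QuantumFieldTheory Literature.MathematicalPhysics.QuantumLattice
open Summit.QuantumFields.YangMills.Theorems.TunedSequenceExists.Negative.Freezing
open Summit.QuantumFields.YangMills.Theorems.TunedSequenceExists.Negative.Glue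
  (continuous_integral_wilsonMeasure)
open Summit.QuantumFields.YangMills.Theorems.FemtoCurvatureTwoPoint.AxisCovNonneg
  (timeAxisCov_nonneg axisProfile_antitone plaqRe_torusConfigShift)
open Summit.QuantumFields.YangMills.Theorems.EquipartitionCriticality.RPProbe
  (torusProj_zero torusProj_single_zero)

namespace Summit.QuantumFields.YangMills.Theorems.TunedSequenceExists.RPDiagonalVariant

/-- The spatial coordinate plane `(1, 2)` of `ℤ⁴` (time is direction `0`). -/
def q12 : {p : Fin 4 × Fin 4 // p.1 < p.2} := ⟨((1 : Fin 4), (2 : Fin 4)), by decide⟩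

variable {G : Type} [Group G] [TopologicalSpace G] [IsTopologicalGroup G] [CompactSpace G]
  [MeasurableSpace G] [BorelSpace G]

/-- `Q := Re tr r(U_{p_{12}(0)})` — the time-zero spatial plaquette at the origin, as an observable
of the infinite lattice (read on periodic configurations through `torusLift`). -/
def spatialPlaquette (r : LatticeRep G) : LGConfig 4 G → ℝ := plaquetteObs r.ρ 0 1 2

/-! ## Bridge to torus coordinates -/

omit [IsTopologicalGroup G] [CompactSpace G] [MeasurableSpace G] [BorelSpace G] in
/-- `Q` read on a periodic configuration is the torus plaquette function at the origin. -/
theorem spatialPlaquette_torusLift (r : LatticeRep G) (S : ℕ) (U : GaugeConfig 4 S G) :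
    spatialPlaquette r (torusLift S U) = WilsonRP.plaqRe r.ρ U ((0 : Site 4 S), q12) := by
  simp only [spatialPlaquette, plaquetteObs, plaquetteHolonomyZd_torusLift', WilsonRP.plaqRe, q12,
    torusProj_zero]

omit [IsTopologicalGroup G] [CompactSpace G] [BorelSpace G] in
/-- `Q` translated by `n e₀` and read on a periodic configuration is the torus plaquette function at
`n e₀`. -/
theorem spatialPlaquette_configShift_torusLift (r : LatticeRep G) (S n : ℕ) (U : GaugeConfig 4 S G) :
    spatialPlaquette r (configShift (-Pi.single 0 (n : ℤ)) (torusLift S U)) =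
      WilsonRP.plaqRe r.ρ U ((Pi.single (0 : Fin 4) ((n : ℕ) : ZMod S) : Site 4 S), q12) := by
  simp only [spatialPlaquette, plaquetteObs, plaquetteHolonomyZd_configShift,
    plaquetteHolonomyZd_torusLift', WilsonRP.plaqRe, q12, zero_sub, neg_neg, torusProj_single_zero]

/-- Translation invariance of the one-point function along the time axis. -/
theorem wilsonExpectation_plaqRe_single (r : LatticeRep G) (β : ℝ) (S : ℕ) [NeZero S] (n : ℕ) :
    wilsonExpectation r.ρ β (fun U : GaugeConfig 4 S G =>
        WilsonRP.plaqRe r.ρ U ((Pi.single (0 : Fin 4) ((n : ℕ) : ZMod S) : Site 4 S), q12)) =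
      wilsonExpectation r.ρ β (fun U : GaugeConfig 4 S G =>
        WilsonRP.plaqRe r.ρ U ((0 : Site 4 S), q12)) := by
  have h := wilsonExpectation_comp_torusConfigShift (d := 4) r.ρ β
    (Pi.single (0 : Fin 4) ((n : ℕ) : ZMod S) : Site 4 S)
    (fun U : GaugeConfig 4 S G =>
      WilsonRP.plaqRe r.ρ U ((Pi.single (0 : Fin 4) ((n : ℕ) : ZMod S) : Site 4 S), q12))
  simp only [Function.comp_def, plaqRe_torusConfigShift, sub_self] at h
  exact h.symm

/-- **Bridge.** The crux-format connected correlator of `Q` is the axis covariance profile of the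
landed RP files (the crux subtracts the unshifted mean; translation invariance identifies the two). -/
theorem latticeConnectedCorr_spatialPlaquette_eq (r : LatticeRep G) (β : ℝ) (S : ℕ) [NeZero S]
    (n : ℕ) :
    latticeConnectedCorr r.ρ β S (spatialPlaquette r) (spatialPlaquette r) n =
      wilsonExpectation r.ρ β (fun U : GaugeConfig 4 S G =>
          WilsonRP.plaqRe r.ρ U ((0 : Site 4 S), q12) *
            WilsonRP.plaqRe r.ρ U ((Pi.single (0 : Fin 4) ((n : ℕ) : ZMod S) : Site 4 S), q12))
        - wilsonExpectation r.ρ β (fun U : GaugeConfig 4 S G =>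
            WilsonRP.plaqRe r.ρ U ((0 : Site 4 S), q12))
          * wilsonExpectation r.ρ β (fun U : GaugeConfig 4 S G =>
            WilsonRP.plaqRe r.ρ U ((Pi.single (0 : Fin 4) ((n : ℕ) : ZMod S) : Site 4 S), q12)) := by
  rw [wilsonExpectation_plaqRe_single]
  simp only [latticeConnectedCorr, wilsonExpectation, spatialPlaquette_torusLift,
    spatialPlaquette_configShift_torusLift]

/-! ## Reflection positivity and transfer monotonicity (landed), in crux format -/

/-- **`0 ≤ ⟨Q ; τ_n Q⟩_{β, S}`** for every compact `G`, every `r`, every side, every `β ≥ 0`. -/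
theorem latticeConnectedCorr_spatialPlaquette_nonneg (r : LatticeRep G) {β : ℝ} (hβ : 0 ≤ β)
    (S : ℕ) [NeZero S] (n : ℕ) :
    0 ≤ latticeConnectedCorr r.ρ β S (spatialPlaquette r) (spatialPlaquette r) n := by
  rw [latticeConnectedCorr_spatialPlaquette_eq]
  exact timeAxisCov_nonneg (d := 3) r.ρ r.continuous hβ q12 (by decide) n

/-- **`n ↦ ⟨Q ; τ_n Q⟩_{β, S}` is non-increasing on the half torus** (`k ≤ n`, `2n ≤ S`). -/
theorem latticeConnectedCorr_spatialPlaquette_antitone (r : LatticeRep G) {β : ℝ} (hβ : 0 ≤ β)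
    (S : ℕ) [NeZero S] {k n : ℕ} (hkn : k ≤ n) (hn : 2 * n ≤ S) :
    latticeConnectedCorr r.ρ β S (spatialPlaquette r) (spatialPlaquette r) n ≤
      latticeConnectedCorr r.ρ β S (spatialPlaquette r) (spatialPlaquette r) k := by
  simp only [latticeConnectedCorr_spatialPlaquette_eq]
  exact axisProfile_antitone (d := 3) r.ρ r.continuous hβ q12 (by decide) _ rfl hkn hn

/-- **Clause (iii) is free for `Q`, lower half**: `0 ≤ N_t`. -/
theorem rescaled_nonneg (r : LatticeRep G) {β : ℝ} (hβ : 0 ≤ β) (M m L n : ℕ) :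
    0 ≤ ((M : ℝ) ^ m) ^ 8 *
      latticeConnectedCorr r.ρ β (2 * L + 1) (spatialPlaquette r) (spatialPlaquette r) n :=
  mul_nonneg (by positivity) (latticeConnectedCorr_spatialPlaquette_nonneg r hβ _ n)

/-- **Clause (iii) is free for `Q`, upper half**: `N_t ≤ N_1` as soon as `2 t M^m ≤ 2L+1`, `t ≥ 1`. -/
theorem rescaled_mul_le (r : LatticeRep G) {β : ℝ} (hβ : 0 ≤ β) (M m L t : ℕ) (ht : 1 ≤ t)
    (htL : 2 * (t * M ^ m) ≤ 2 * L + 1) :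
    ((M : ℝ) ^ m) ^ 8 *
        latticeConnectedCorr r.ρ β (2 * L + 1) (spatialPlaquette r) (spatialPlaquette r) (t * M ^ m) ≤
      ((M : ℝ) ^ m) ^ 8 *
        latticeConnectedCorr r.ρ β (2 * L + 1) (spatialPlaquette r) (spatialPlaquette r) (M ^ m) :=
  mul_le_mul_of_nonneg_left
    (latticeConnectedCorr_spatialPlaquette_antitone r hβ _ (Nat.le_mul_of_pos_left _ ht) htL)
    (by positivity)

/-! ## Freezing and β-continuity for `Q` (same engine as for the corner density) -/

/-- **Freezing**: `⟨Q ; τ_m Q⟩_{β, S} → 0` as `β → ∞` on a fixed torus. -/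
theorem latticeConnectedCorr_spatialPlaquette_tendsto_zero (r : LatticeRep G) (S : ℕ) [NeZero S]
    (m : ℕ) :
    Tendsto (fun β : ℝ => latticeConnectedCorr r.ρ β S (spatialPlaquette r) (spatialPlaquette r) m)
      atTop (𝓝 0) := by
  haveI : SecondCountableTopology G := secondCountable_of_latticeRep r
  have hρN : ∀ g, (r.ρ g).trace.re ≤ r.N := fun g => re_trace_le_of_mem_unitaryGroup (r.mem_unitary g)
  have hA : Continuous fun U : GaugeConfig 4 S G => WilsonRP.plaqRe r.ρ U ((0 : Site 4 S), q12) :=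
    (continuous_trace_re r.ρ r.continuous).comp (continuous_plaquetteHolonomy _ _ _)
  have hB : Continuous fun U : GaugeConfig 4 S G =>
      WilsonRP.plaqRe r.ρ U ((Pi.single (0 : Fin 4) ((m : ℕ) : ZMod S) : Site 4 S), q12) :=
    (continuous_trace_re r.ρ r.continuous).comp (continuous_plaquetteHolonomy _ _ _)
  have hflat : ∀ (U : GaugeConfig 4 S G), wilsonAction r.ρ U = 0 → ∀ x : Site 4 S,
      WilsonRP.plaqRe r.ρ U (x, q12) = r.N := fun U hU x =>
    re_trace_eq_of_wilsonAction_eq_zero r.ρ hρN hU x 1 2 (by decide)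
  have h1 := tendsto_integral_wilsonMeasure r.ρ r.continuous hρN (hA.mul hB)
    (c := (r.N : ℝ) * r.N) fun U hU => by simp only [Pi.mul_apply, hflat U hU]
  have h2 := tendsto_integral_wilsonMeasure r.ρ r.continuous hρN hA (c := (r.N : ℝ))
    fun U hU => hflat U hU _
  have h3 := tendsto_integral_wilsonMeasure r.ρ r.continuous hρN hB (c := (r.N : ℝ))
    fun U hU => hflat U hU _
  have h := h1.sub (h2.mul h3)
  rw [sub_self] at h
  simp only [Pi.mul_apply] at h
  simpa only [latticeConnectedCorr_spatialPlaquette_eq, wilsonExpectation] using h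

/-- **β-continuity** of `β ↦ ⟨Q ; τ_m Q⟩_{β, S}` on a fixed torus. -/
theorem continuous_latticeConnectedCorr_spatialPlaquette (r : LatticeRep G) (S : ℕ) [NeZero S]
    (m : ℕ) :
    Continuous fun β : ℝ =>
      latticeConnectedCorr r.ρ β S (spatialPlaquette r) (spatialPlaquette r) m := by
  haveI : SecondCountableTopology G := secondCountable_of_latticeRep r
  have hA : Continuous fun U : GaugeConfig 4 S G => WilsonRP.plaqRe r.ρ U ((0 : Site 4 S), q12) :=
    (continuous_trace_re r.ρ r.continuous).comp (continuous_plaquetteHolonomy _ _ _)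
  have hB : Continuous fun U : GaugeConfig 4 S G =>
      WilsonRP.plaqRe r.ρ U ((Pi.single (0 : Fin 4) ((m : ℕ) : ZMod S) : Site 4 S), q12) :=
    (continuous_trace_re r.ρ r.continuous).comp (continuous_plaquetteHolonomy _ _ _)
  have h1 := continuous_integral_wilsonMeasure r.ρ r.continuous (hA.mul hB)
  have h2 := continuous_integral_wilsonMeasure r.ρ r.continuous hA
  have h3 := continuous_integral_wilsonMeasure r.ρ r.continuous hB
  simp only [latticeConnectedCorr_spatialPlaquette_eq, wilsonExpectation]
  exact h1.sub (h2.mul h3)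

/-! ## (V) for `Q` restricted to finitely many depths is free -/

/-- **Volume quasi-monotonicity for `Q` on any FINITE set of depths** (freezing on the small tori
+ non-negativity on the big ones): the content of (V) for an RP-diagonal observable is only the
uniformity in the depth `m`. -/
theorem volumeMonotoneQ_on_finset (r : LatticeRep G) (M L₁ : ℕ) (hL₁ : 2 ≤ L₁) (F : Finset ℕ)
    {c : ℝ} (hc : 0 < c) :
    ∃ β₁ : ℝ, ∀ β : ℝ, β₁ ≤ β → ∀ m ∈ F, ∀ L : ℕ, L₁ * M ^ m ≤ L →
      ((M : ℝ) ^ m) ^ 8 *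
          latticeConnectedCorr r.ρ β (2 * (L₁ * M ^ m) + 1) (spatialPlaquette r) (spatialPlaquette r)
            (M ^ m) - c / Real.log L₁ ^ 2 ≤
        ((M : ℝ) ^ m) ^ 8 *
          latticeConnectedCorr r.ρ β (2 * L + 1) (spatialPlaquette r) (spatialPlaquette r) (M ^ m) := by
  have hlog : 0 < Real.log L₁ := Real.log_pos (by exact_mod_cast hL₁)
  have hpos : (0 : ℝ) < c / Real.log L₁ ^ 2 := div_pos hc (pow_pos hlog 2)
  have hsmall : ∀ᶠ β : ℝ in atTop, ∀ m ∈ F, ((M : ℝ) ^ m) ^ 8 *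
      latticeConnectedCorr r.ρ β (2 * (L₁ * M ^ m) + 1) (spatialPlaquette r) (spatialPlaquette r)
        (M ^ m) < c / Real.log L₁ ^ 2 := by
    refine (F.eventually_all).2 fun m _ => ?_
    have h := (latticeConnectedCorr_spatialPlaquette_tendsto_zero r (2 * (L₁ * M ^ m) + 1)
      (M ^ m)).const_mul (((M : ℝ) ^ m) ^ 8)
    rw [mul_zero] at h
    exact h.eventually_lt_const hpos
  obtain ⟨B, hB⟩ := eventually_atTop.1 hsmall
  refine ⟨max B 0, fun β hβ m hm L _ => ?_⟩
  have h1 := hB β ((le_max_left _ _).trans hβ) m hm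
  have h2 := rescaled_nonneg r ((le_max_right _ _).trans hβ) M m L (M ^ m)
  linarith

end Summit.QuantumFields.YangMills.Theorems.TunedSequenceExists.RPDiagonalVariant

end
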